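import Literature.AlgebraicGeometry.HodgeTheory.AbelianVarietyEndAlgebraCommutativeCriterion
import HarnessLib

/-!
# Simple abelian subvarieties: a multiplicity-free `X` contains exactly `r` of them (its isotypic components), every other
# `X` infinitely many; `#{abelian subvarieties} = 2^{#{simple abelian subvarieties}}`
# (Mumford §19 Cor. 1–2; Silverberg–Zarhin 2015 Def. 2.2–2.3; Zarhin 2008 Thm. 3.2)

Layer `Literature/AlgebraicGeometry/HodgeTheory`; theorems only (no `def`, no instance, no named fact; net debt 0).  The lattice
results of `HodgeTheory/AbelianVarietyMultiplicityFreeSubvarieties` ∕ `…SubvarietiesFiniteIffMultiplicityFree` count ALL abelian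
subvarieties (`2^r` or infinitely many); this file counts the SIMPLE ones (abelian subvarieties `Z ↪ X` with `Z` simple of positive
dimension, recorded by their closed subsets).  §1 (any field): a finite homomorphism `B ⊞ B → X` with `B` simple of positive
dimension yields infinitely many simple abelian subvarieties (the images of the graphs `Γ_n`, all isogenous to `B`); a repeated
factor of a system of components yields such a map; the partial sums `⨁_{t ∈ T} Y_t → X` of a system whose addition map is an
isogeny are finite, so an abelian subvariety with the same closed subset has dimension `Σ_{t ∈ T} dim Y_t`.  §2 (perfect
field): in a multiplicity-free `X` (a `Hom`-orthogonal system of SIMPLE `i_q : Y_q ↪ X` of positive dimension with `⨁ Y_q → X` an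
isogeny) the simple abelian subvarieties are exactly the `Y_q` — there are `#Q` of them; for every `X`: finitely many simple
abelian subvarieties ⟺ finitely many abelian subvarieties, and then `#{all} = 2^{#{simple}}`.

THE PRINT.  Mumford, *Abelian Varieties* (1970) §19 Cor. 1–2 of Thm. 1 (pp. 173–174: `X ∼ ∏ X_i^{n_i}` with the simple `X_i` and
the `n_i` unique); Silverberg–Zarhin, *Isogenies of abelian varieties over finite fields* (2015) Def. 2.2–2.3 (p. 3: isotypic
components = maximal isotypic abelian subvarieties) and Lemma 3.1 (p. 5); Zarhin 2008 Thm. 3.2 (p. 7; Lenstra–Oort–Zarhin 1996);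
Milne 1986 §12 Prop. 12.1 (PDF p. 189).

Results (namespace `Literature.AlgebraicGeometry.HodgeTheory.AbelianVariety`):
* §1 (any field) **`infinite_setOf_range_simple_subvariety_of_isFinite_biprod`**, `exists_isFinite_biprod_hom_of_component`,
  `infinite_setOf_range_simple_subvariety_of_component`, `infinite_setOf_range_simple_subvariety_biprod_self`,
  **`isFinite_toSchemeHom_biproduct_desc_restrict`** (partial sums are finite), `range_biproduct_desc_singleton`,
  `isIsogenous_biproduct_restrict_of_range_eq`, `dim_eq_sum_of_range_eq_range_biproduct_desc`;
* §2 (perfect field) **`exists_range_eq_range_component_of_isSimple`** (a simple abelian subvariety of a multiplicity-free `X` IS a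
  component), **`setOf_range_simple_subvariety_eq_range_components`**, **`natCard_setOf_range_simple_subvariety_of_isSimple_components`**
  (`= #Q`), `infinite_setOf_range_simple_subvariety_of_one_le_multiplicity`,
  **`finite_setOf_range_simple_subvariety_iff_finite_setOf_range_subvariety`** (every `X`),
  **`natCard_setOf_range_subvariety_eq_two_pow_natCard_simple`** (`#{abelian subvarieties} = 2^{#{simple ones}}` when finite).

## References
* [MumfordAV1970] D. Mumford, *Abelian Varieties* (1970), §19 Thm. 1, Cor. 1–2, Thm. 3 (pp. 173–176).
* [SilverbergZarhin2015] A. Silverberg, Yu. G. Zarhin, *Isogenies of abelian varieties over finite fields* (2015)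
  (arXiv:1409.0592), Def. 2.2–2.3 (p. 3), Lemma 3.1 (p. 5).
* [Zarhin2008HomomorphismsFiniteFields] Yu. G. Zarhin, *Homomorphisms of abelian varieties over finite fields* (2008)
  (arXiv:0711.1615), Thm. 3.2 (p. 7).
* [Milne1986AbelianVarieties] J. S. Milne, *Abelian Varieties*, in Cornell–Silverman (1986), §12 Prop. 12.1 (PDF p. 189).
-/

noncomputable section

universe u

open CategoryTheory CategoryTheory.Limits

namespace Literature.AlgebraicGeometry.HodgeTheory

namespace AbelianVariety

open _root_.AlgebraicGeometry
open Literature.AlgebraicGeometry.Motives Literature.AlgebraicGeometry.Motives.AbelianVariety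

variable {K : Type u} [Field K]

/-! ## §1 Infinitely many simple abelian subvarieties from a repeated factor; partial sums are finite (any field) -/

section AnyField

variable {X B : Motives.AbelianVariety K} {Q : Type} {Y : Q → Motives.AbelianVariety K}

/-- **A finite `w : B ⊞ B → X` with `B` SIMPLE of positive dimension gives infinitely many SIMPLE abelian subvarieties of `X`**:
the images of the graphs `Γ_n = (1, n) : B ↪ B ⊞ B` under `w` are pairwise distinct and each is isogenous to `B`.
[cite: Zarhin2008HomomorphismsFiniteFields, Thm. 3.2 (p. 7)] [cite: MumfordAV1970, §19 Cor. 1–2 of Thm. 1 (pp. 173–174)] -/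
theorem infinite_setOf_range_simple_subvariety_of_isFinite_biprod (w : B ⊞ B ⟶ X) [IsFinite (Hom.toSchemeHom w)]
    (hBs : B.IsSimple) (hB : 0 < B.dim) :
    {R : Set X.X.left | ∃ (Z : Motives.AbelianVariety K) (j : Z ⟶ X),
        IsClosedImmersion (Hom.toSchemeHom j) ∧ R = Set.range (Hom.toSchemeHom j) ∧ Z.IsSimple ∧ 0 < Z.dim}.Infinite := by
  haveI : ∀ k : ℕ, IsFinite (Hom.toSchemeHom (biprod.lift (𝟙 B) (k • 𝟙 B) ≫ w)) := fun k ↦ by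
    haveI := isClosedImmersion_toSchemeHom_biprod_lift_id_left (k • 𝟙 B)
    exact isFinite_toSchemeHom_comp _ _
  refine Set.infinite_of_injective_forall_mem (injective_range_graph_comp w hB) fun n ↦
    ⟨_, imageι (biprod.lift (𝟙 B) (n • 𝟙 B) ≫ w), inferInstance, (range_toSchemeHom_imageι _).symm, ?_, ?_⟩
  · exact (isIsogenous_image_of_isFinite (biprod.lift (𝟙 B) (n • 𝟙 B) ≫ w)).symm'.isSimple_symm hBs
  · rw [dim_image_eq_of_isFinite]
    exact hB

variable [Fintype Q]

/-- A member `Y_q ∼ B^ι` with two indices `k₀ ≠ k₁` of a family of abelian subvarieties `i_q : Y_q ↪ X` whose addition map is an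
isogeny gives a FINITE homomorphism `w = (b_{k₀}, b_{k₁}) : B ⊞ B → X` (`w ≫ (a_{k₀}, a_{k₁}) = M • 𝟙`, matrix units of
`…CommutativeEndSubvarieties.exists_matrixUnits_of_component`). [cite: MumfordAV1970, §19 Cor. 2 of Thm. 1 (p. 174) and Remark p. 169] -/
theorem exists_isFinite_biprod_hom_of_component (i : ∀ q, Y q ⟶ X) (hi : ∀ q, IsClosedImmersion (Hom.toSchemeHom (i q)))
    (hdesc : IsIsogeny (biproduct.desc i)) {q : Q} {ι : Type} [Fintype ι] (hY : IsIsogenous (Y q) (⨁ fun _ : ι ↦ B))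
    {k₀ k₁ : ι} (hk : k₀ ≠ k₁) : ∃ w : B ⊞ B ⟶ X, IsFinite (Hom.toSchemeHom w) := by
  obtain ⟨a, b, M, hM, -, hdiag, hoff⟩ := exists_matrixUnits_of_component i hi hdesc hY
  refine ⟨biprod.desc (b k₀) (b k₁), isFinite_of_comp_eq_nsmul_id hM (v := biprod.lift (a k₀) (a k₁)) ?_⟩
  refine biprod.hom_ext' _ _ (biprod.hom_ext _ _ ?_ ?_) (biprod.hom_ext _ _ ?_ ?_) <;>
    simp only [biprod.inl_desc_assoc, biprod.inr_desc_assoc, Category.assoc, biprod.lift_fst, biprod.lift_snd, hdiag,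
      hoff k₀ k₁ hk, hoff k₁ k₀ hk.symm, Preadditive.comp_nsmul, Preadditive.nsmul_comp, Category.comp_id, biprod.inl_fst,
      biprod.inl_snd, biprod.inr_fst, biprod.inr_snd, smul_zero]

/-- **A repeated SIMPLE factor gives infinitely many simple abelian subvarieties** (any field): a member `Y_q ∼ B^ι`, `k₀ ≠ k₁`,
`B` simple of positive dimension. [cite: Zarhin2008HomomorphismsFiniteFields, Thm. 3.2 (p. 7)] [cite: MumfordAV1970, §19 Cor. 1–2 of Thm. 1 (pp. 173–174)] -/
theorem infinite_setOf_range_simple_subvariety_of_component (i : ∀ q, Y q ⟶ X)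
    (hi : ∀ q, IsClosedImmersion (Hom.toSchemeHom (i q))) (hdesc : IsIsogeny (biproduct.desc i)) {q : Q} {ι : Type}
    [Fintype ι] (hY : IsIsogenous (Y q) (⨁ fun _ : ι ↦ B)) {k₀ k₁ : ι} (hk : k₀ ≠ k₁) (hBs : B.IsSimple) (hB : 0 < B.dim) :
    {R : Set X.X.left | ∃ (Z : Motives.AbelianVariety K) (j : Z ⟶ X),
        IsClosedImmersion (Hom.toSchemeHom j) ∧ R = Set.range (Hom.toSchemeHom j) ∧ Z.IsSimple ∧ 0 < Z.dim}.Infinite := by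
  obtain ⟨w, hw⟩ := exists_isFinite_biprod_hom_of_component i hi hdesc hY hk
  haveI := hw
  exact infinite_setOf_range_simple_subvariety_of_isFinite_biprod w hBs hB

omit [Fintype Q] in
/-- `B ⊞ B` for `B` simple of positive dimension has infinitely many simple abelian subvarieties (the graphs `Γ_n ≅ B`; any field).
[cite: Zarhin2008HomomorphismsFiniteFields, Thm. 3.2 (p. 7)] -/
theorem infinite_setOf_range_simple_subvariety_biprod_self (hBs : B.IsSimple) (hB : 0 < B.dim) :
    {R : Set (B ⊞ B).X.left | ∃ (Z : Motives.AbelianVariety K) (j : Z ⟶ B ⊞ B),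
        IsClosedImmersion (Hom.toSchemeHom j) ∧ R = Set.range (Hom.toSchemeHom j) ∧ Z.IsSimple ∧ 0 < Z.dim}.Infinite := by
  haveI := isClosedImmersion_toSchemeHom_id (B ⊞ B)
  exact infinite_setOf_range_simple_subvariety_of_isFinite_biprod (𝟙 (B ⊞ B)) hBs hB

/-- **Partial sums are finite**: if the addition map `⨁_q Y_q → X` is an isogeny, every partial addition map `⨁_{t ∈ T} Y_t → X` is
a finite homomorphism (it is `ι_T ≫ (⨁_q Y_q → X)` with `ι_T : ⨁_{t ∈ T} Y_t ↪ ⨁_q Y_q` split by the projection).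
[cite: MumfordAV1970, §19 Thm. 1 and Remark p. 169 (pp. 169–173)] -/
theorem isFinite_toSchemeHom_biproduct_desc_restrict (i : ∀ q, Y q ⟶ X) (hdesc : IsIsogeny (biproduct.desc i)) (T : Finset Q) :
    IsFinite (Hom.toSchemeHom (biproduct.desc fun t : T ↦ i t)) := by
  classical
  set ιT : (⨁ fun t : T ↦ Y t) ⟶ ⨁ Y := biproduct.desc fun t : T ↦ biproduct.ι Y t.1 with hιT
  set πT : (⨁ Y) ⟶ ⨁ fun t : T ↦ Y t := biproduct.lift fun t : T ↦ biproduct.π Y t.1 with hπT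
  have hsplit : ιT ≫ πT = (1 : ℕ) • 𝟙 _ := by
    rw [one_nsmul]
    refine biproduct.hom_ext _ _ fun t' ↦ biproduct.hom_ext' _ _ fun t ↦ ?_
    simp only [hιT, hπT, Category.assoc, biproduct.lift_π, biproduct.ι_desc_assoc, Category.id_comp, biproduct.ι_π]
    by_cases h : t = t'
    · subst h
      rw [dif_pos rfl, dif_pos rfl]
    · rw [dif_neg h, dif_neg fun h' ↦ h (Subtype.ext h')]
  have hfac : (biproduct.desc fun t : T ↦ i t) = ιT ≫ biproduct.desc i :=
    biproduct.hom_ext' _ _ fun t ↦ by rw [hιT, biproduct.ι_desc_assoc, biproduct.ι_desc, biproduct.ι_desc]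
  haveI : IsFinite (Hom.toSchemeHom ιT) := isFinite_of_comp_eq_nsmul_id one_ne_zero hsplit
  haveI : IsFinite (Hom.toSchemeHom (biproduct.desc i)) := hdesc.2
  rw [hfac]
  exact isFinite_toSchemeHom_comp _ _

omit [Fintype Q] in
/-- `range (⨁_{t ∈ {q}} Y_t → X) = range (i_q)`: the partial sum over a singleton is the component (any field).
[cite: MumfordAV1970, §19 Thm. 1 (p. 173)] -/
theorem range_biproduct_desc_singleton (i : ∀ q, Y q ⟶ X) (q : Q) :
    Set.range (Hom.toSchemeHom (biproduct.desc fun t : ({q} : Finset Q) ↦ i t)) = Set.range (Hom.toSchemeHom (i q)) := by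
  refine le_antisymm ?_ ?_
  · have key : ∀ (t : Q) (h : t = q), i t = eqToHom (congrArg Y h) ≫ i q := by
      rintro t rfl
      rw [eqToHom_refl, Category.id_comp]
    have hfac : (biproduct.desc fun t : ({q} : Finset Q) ↦ i t) =
        (biproduct.desc fun t : ({q} : Finset Q) ↦ eqToHom (congrArg Y (Finset.mem_singleton.1 t.2))) ≫ i q :=
      biproduct.hom_ext' _ _ fun t ↦ by
        rw [biproduct.ι_desc, biproduct.ι_desc_assoc]
        exact key t.1 (Finset.mem_singleton.1 t.2)
    rw [hfac]
    exact range_toSchemeHom_comp_subset _ _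
  · have hfac : i q = biproduct.ι (fun t : ({q} : Finset Q) ↦ Y t) ⟨q, Finset.mem_singleton_self q⟩ ≫
        biproduct.desc fun t : ({q} : Finset Q) ↦ i t := by rw [biproduct.ι_desc]
    conv_lhs => rw [hfac]
    exact range_toSchemeHom_comp_subset _ _

/-- An abelian subvariety `j : Z ↪ X` whose closed subset is that of the partial sum `⨁_{t ∈ T} Y_t → X` is isogenous to
`⨁_{t ∈ T} Y_t` (addition map an isogeny; any field). [cite: MumfordAV1970, §19 Thm. 1 and Cor. 1 (p. 173)] -/
theorem isIsogenous_biproduct_restrict_of_range_eq (i : ∀ q, Y q ⟶ X) (hdesc : IsIsogeny (biproduct.desc i))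
    {Z : Motives.AbelianVariety K} (j : Z ⟶ X) [IsClosedImmersion (Hom.toSchemeHom j)] (T : Finset Q)
    (hT : Set.range (Hom.toSchemeHom j) = Set.range (Hom.toSchemeHom (biproduct.desc fun t : T ↦ i t))) :
    IsIsogenous Z (⨁ fun t : T ↦ Y t) := by
  haveI := isFinite_toSchemeHom_biproduct_desc_restrict i hdesc T
  obtain ⟨e, -⟩ := exists_iso_of_range_eq j (imageι (biproduct.desc fun t : T ↦ i t))
    (hT.trans (range_toSchemeHom_imageι _).symm)
  exact IsIsogenous.trans ⟨e.hom, isIsogeny_hom_of_iso e⟩ (isIsogenous_image_of_isFinite _).symm'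

/-- **`dim Z = Σ_{t ∈ T} dim Y_t`** for an abelian subvariety `Z ↪ X` with the closed subset of the partial sum `⨁_{t ∈ T} Y_t → X`
(addition map an isogeny; any field). [cite: MumfordAV1970, §19 Cor. 1 of Thm. 1 (p. 173)] [cite: Milne1986AbelianVarieties, §12 Prop. 12.1 (PDF p. 189)] -/
theorem dim_eq_sum_of_range_eq_range_biproduct_desc (i : ∀ q, Y q ⟶ X) (hdesc : IsIsogeny (biproduct.desc i))
    {Z : Motives.AbelianVariety K} (j : Z ⟶ X) [IsClosedImmersion (Hom.toSchemeHom j)] (T : Finset Q)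
    (hT : Set.range (Hom.toSchemeHom j) = Set.range (Hom.toSchemeHom (biproduct.desc fun t : T ↦ i t))) :
    Z.dim = ∑ t ∈ T, (Y t).dim := by
  rw [(isIsogenous_biproduct_restrict_of_range_eq i hdesc j T hT).dim_eq, dim_biproduct]
  exact (Finset.sum_subtype T (fun _ ↦ Iff.rfl) fun q ↦ (Y q).dim).symm

end AnyField

/-! ## §2 The simple abelian subvarieties of a multiplicity-free `X` are its components (perfect field) -/

section Perfect

variable [PerfectField K] {X Z : Motives.AbelianVariety K} {Q : Type} [Fintype Q] {Y : Q → Motives.AbelianVariety K}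
  {B : Q → Motives.AbelianVariety K} {n : Q → ℕ}

/-- **A SIMPLE ABELIAN SUBVARIETY OF A MULTIPLICITY-FREE `X` IS ONE OF ITS COMPONENTS** (perfect field): for a `Hom`-orthogonal
system of simple `i_q : Y_q ↪ X` of positive dimension with `⨁ Y_q → X` an isogeny and `j : Z ↪ X` with `Z` simple of positive
dimension, `range j = range (i q)` for some `q` (`Z` is a partial sum `⨁_{t ∈ T} Y_t`, and simplicity forces `T = {q}`).
[cite: SilverbergZarhin2015, Def. 2.2–2.3 (p. 3) and Lemma 3.1 (p. 5)] [cite: MumfordAV1970, §19 Cor. 1–2 of Thm. 1 (pp. 173–174)] -/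
theorem exists_range_eq_range_component_of_isSimple (i : ∀ q, Y q ⟶ X)
    (hi : ∀ q, IsClosedImmersion (Hom.toSchemeHom (i q))) (hdesc : IsIsogeny (biproduct.desc i))
    (horth : ∀ q q', q ≠ q' → ∀ f : Y q ⟶ Y q', f = 0) (hYs : ∀ q, (Y q).IsSimple) (hY0 : ∀ q, 0 < (Y q).dim)
    (j : Z ⟶ X) [IsClosedImmersion (Hom.toSchemeHom j)] (hZ : Z.IsSimple) (hZ0 : 0 < Z.dim) :
    ∃ q, Set.range (Hom.toSchemeHom j) = Set.range (Hom.toSchemeHom (i q)) := by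
  classical
  obtain ⟨T, hT⟩ := exists_range_eq_range_biproduct_desc_of_isSimple_of_perfectField i hi hdesc horth hYs j
  have hZT := isIsogenous_biproduct_restrict_of_range_eq i hdesc j T hT
  -- `T` is non-empty (`0 < dim Z`) …
  have hne : T.Nonempty := by
    by_contra h
    rw [Finset.not_nonempty_iff_eq_empty] at h
    subst h
    have hd := dim_eq_sum_of_range_eq_range_biproduct_desc i hdesc j ∅ hT
    rw [Finset.sum_empty] at hd
    omega
  obtain ⟨q, hq⟩ := hne
  -- … and has no second element (`Z ∼ ⨁_T Y_t` is simple)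
  have hTq : T = {q} := by
    refine Finset.eq_singleton_iff_unique_mem.2 ⟨hq, fun t ht ↦ ?_⟩
    by_contra htq
    exact not_isSimple_biproduct_of_ne_of_dim_pos (f := fun t : T ↦ Y t) (j := ⟨t, ht⟩) (j' := ⟨q, hq⟩)
      (fun h ↦ htq (congrArg Subtype.val h)) (hY0 t) (hY0 q) (hZT.symm'.isSimple_symm hZ)
  subst hTq
  exact ⟨q, hT.trans (range_biproduct_desc_singleton i q)⟩

/-- **THE SIMPLE ABELIAN SUBVARIETIES OF A MULTIPLICITY-FREE `X` ARE EXACTLY ITS COMPONENTS `Y_q`** (as closed subsets; perfect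
field). [cite: SilverbergZarhin2015, Def. 2.2–2.3 (p. 3)] [cite: MumfordAV1970, §19 Cor. 1–2 of Thm. 1 (pp. 173–174)] -/
theorem setOf_range_simple_subvariety_eq_range_components (i : ∀ q, Y q ⟶ X)
    (hi : ∀ q, IsClosedImmersion (Hom.toSchemeHom (i q))) (hdesc : IsIsogeny (biproduct.desc i))
    (horth : ∀ q q', q ≠ q' → ∀ f : Y q ⟶ Y q', f = 0) (hYs : ∀ q, (Y q).IsSimple) (hY0 : ∀ q, 0 < (Y q).dim) :
    {R : Set X.X.left | ∃ (Z : Motives.AbelianVariety K) (j : Z ⟶ X),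
        IsClosedImmersion (Hom.toSchemeHom j) ∧ R = Set.range (Hom.toSchemeHom j) ∧ Z.IsSimple ∧ 0 < Z.dim} =
      Set.range fun q ↦ Set.range (Hom.toSchemeHom (i q)) := by
  ext R
  constructor
  · rintro ⟨Z, j, hj, rfl, hZ, hZ0⟩
    haveI := hj
    obtain ⟨q, hq⟩ := exists_range_eq_range_component_of_isSimple i hi hdesc horth hYs hY0 j hZ hZ0
    exact ⟨q, hq.symm⟩
  · rintro ⟨q, rfl⟩
    exact ⟨Y q, i q, hi q, rfl, hYs q, hY0 q⟩

/-- **A MULTIPLICITY-FREE `X` HAS EXACTLY `#Q` SIMPLE ABELIAN SUBVARIETIES** (perfect field; the components are pairwise distinct as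
closed subsets). [cite: MumfordAV1970, §19 Cor. 1 of Thm. 1 (p. 173: the `X_i` are determined up to isogeny)] [cite: SilverbergZarhin2015, Def. 2.2–2.3 (p. 3)] -/
theorem natCard_setOf_range_simple_subvariety_of_isSimple_components (i : ∀ q, Y q ⟶ X)
    (hi : ∀ q, IsClosedImmersion (Hom.toSchemeHom (i q))) (hdesc : IsIsogeny (biproduct.desc i))
    (horth : ∀ q q', q ≠ q' → ∀ f : Y q ⟶ Y q', f = 0) (hYs : ∀ q, (Y q).IsSimple) (hY0 : ∀ q, 0 < (Y q).dim) :
    Nat.card {R : Set X.X.left | ∃ (Z : Motives.AbelianVariety K) (j : Z ⟶ X),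
        IsClosedImmersion (Hom.toSchemeHom j) ∧ R = Set.range (Hom.toSchemeHom j) ∧ Z.IsSimple ∧ 0 < Z.dim} = Fintype.card Q := by
  classical
  obtain ⟨v, m, hm, hdv, hvd⟩ := IsIsogeny.exists_nsmul_inverse_holds hdesc
  have hinj : Function.Injective fun q ↦ Set.range (Hom.toSchemeHom (i q)) := fun q q' hqq' ↦ by
    have h := injective_range_biproduct_desc_components i hi hdv hvd hm.ne' hY0 (a₁ := {q}) (a₂ := {q'})
      (by simp only [range_biproduct_desc_singleton]; exact hqq')
    exact Finset.singleton_injective h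
  rw [setOf_range_simple_subvariety_eq_range_components i hi hdesc horth hYs hY0, Nat.card_range_of_injective hinj,
    Nat.card_eq_fintype_card]

omit [PerfectField K] in
/-- A component `Y_q ∼ B_q^{n_q+1}` of multiplicity `n_q ≥ 1` (`B_q` simple of positive dimension) gives infinitely many simple
abelian subvarieties (any field). [cite: Zarhin2008HomomorphismsFiniteFields, Thm. 3.2 (p. 7)] -/
theorem infinite_setOf_range_simple_subvariety_of_one_le_multiplicity (hB : ∀ q, (B q).IsSimple) (hB0 : ∀ q, 0 < (B q).dim)
    (hY : ∀ q, IsIsogenous (Y q) (⨁ fun _ : Fin (n q + 1) ↦ B q)) (i : ∀ q, Y q ⟶ X)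
    (hi : ∀ q, IsClosedImmersion (Hom.toSchemeHom (i q))) (hdesc : IsIsogeny (biproduct.desc i)) {q : Q} (hq : 1 ≤ n q) :
    {R : Set X.X.left | ∃ (Z : Motives.AbelianVariety K) (j : Z ⟶ X),
        IsClosedImmersion (Hom.toSchemeHom j) ∧ R = Set.range (Hom.toSchemeHom j) ∧ Z.IsSimple ∧ 0 < Z.dim}.Infinite :=
  infinite_setOf_range_simple_subvariety_of_component i hi hdesc (hY q) (k₀ := (⟨0, by omega⟩ : Fin (n q + 1)))
    (k₁ := (⟨1, by omega⟩ : Fin (n q + 1))) (Fin.ne_of_val_ne (by norm_num)) (hB q) (hB0 q)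

/-- **FINITELY MANY SIMPLE ABELIAN SUBVARIETIES ⟺ FINITELY MANY ABELIAN SUBVARIETIES** (every abelian variety over a perfect field):
finiteness already fails at the level of simple abelian subvarieties as soon as some isotypic component has multiplicity `≥ 2`.
[cite: Zarhin2008HomomorphismsFiniteFields, Thm. 3.2 (p. 7)] [cite: MumfordAV1970, §19 Cor. 1–2 of Thm. 1 (pp. 173–174)] -/
theorem finite_setOf_range_simple_subvariety_iff_finite_setOf_range_subvariety (X : Motives.AbelianVariety K) :
    {R : Set X.X.left | ∃ (Z : Motives.AbelianVariety K) (j : Z ⟶ X),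
        IsClosedImmersion (Hom.toSchemeHom j) ∧ R = Set.range (Hom.toSchemeHom j) ∧ Z.IsSimple ∧ 0 < Z.dim}.Finite ↔
      {R : Set X.X.left | ∃ (Z : Motives.AbelianVariety K) (j : Z ⟶ X),
        IsClosedImmersion (Hom.toSchemeHom j) ∧ R = Set.range (Hom.toSchemeHom j)}.Finite := by
  constructor
  · intro hfin
    by_contra hinf
    obtain ⟨r, B, n, Y, i, hB, hB0, hni, hi, hY, -, hdesc, -⟩ := exists_isotypicComponents_orthogonal X
    have h0 : ¬ ∀ q, n q = 0 := fun h0 ↦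
      hinf ((finite_setOf_range_subvariety_iff_forall_multiplicity_eq_zero hB hB0 hni hY i hi hdesc).2 h0)
    obtain ⟨q, hq⟩ := not_forall.1 h0
    exact infinite_setOf_range_simple_subvariety_of_one_le_multiplicity hB hB0 hY i hi hdesc (Nat.one_le_iff_ne_zero.2 hq) hfin
  · exact fun hfin ↦ hfin.subset fun R ⟨Z, j, hj, hR, _, _⟩ ↦ ⟨Z, j, hj, hR⟩

/-- **`#{abelian subvarieties of X} = 2 ^ #{simple abelian subvarieties of X}`** when these sets are finite (perfect field; both
counted by their closed subsets): `X` is then multiplicity-free with `r` components, `2^r` abelian subvarieties, `r` simple ones.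
[cite: MumfordAV1970, §19 Cor. 1–2 of Thm. 1 (pp. 173–174)] [cite: Zarhin2008HomomorphismsFiniteFields, Thm. 3.2 (p. 7)] -/
theorem natCard_setOf_range_subvariety_eq_two_pow_natCard_simple (X : Motives.AbelianVariety K)
    (hfin : {R : Set X.X.left | ∃ (Z : Motives.AbelianVariety K) (j : Z ⟶ X),
        IsClosedImmersion (Hom.toSchemeHom j) ∧ R = Set.range (Hom.toSchemeHom j)}.Finite) :
    Nat.card {R : Set X.X.left | ∃ (Z : Motives.AbelianVariety K) (j : Z ⟶ X),
        IsClosedImmersion (Hom.toSchemeHom j) ∧ R = Set.range (Hom.toSchemeHom j)} =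
      2 ^ Nat.card {R : Set X.X.left | ∃ (Z : Motives.AbelianVariety K) (j : Z ⟶ X),
        IsClosedImmersion (Hom.toSchemeHom j) ∧ R = Set.range (Hom.toSchemeHom j) ∧ Z.IsSimple ∧ 0 < Z.dim} := by
  obtain ⟨r, B, n, Y, i, hB, hB0, hni, hi, hY, -, hdesc, -⟩ := exists_isotypicComponents_orthogonal X
  have h0 : ∀ q, n q = 0 := (finite_setOf_range_subvariety_iff_forall_multiplicity_eq_zero hB hB0 hni hY i hi hdesc).1 hfin
  have hYB : ∀ q, IsIsogenous (Y q) (B q) := fun q ↦ by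
    have hd : (Y q).dim = (B q).dim := by
      rw [dim_eq_mul_of_isIsogenous_biproduct_const (hY q), h0 q, zero_add, one_mul]
    exact isIsogenous_of_isIsogenous_biproduct_const_of_dim_le (hY q) (by rw [hd]; exact hB0 q) hd.le
  have horth : ∀ q q', q ≠ q' → ∀ f : Y q ⟶ Y q', f = 0 := fun q q' hqq' f ↦
    hom_eq_zero_of_isIsogenous_biproduct_const_of_ne hB hB0 hni hqq' (hY q) (hY q') f
  have hYs : ∀ q, (Y q).IsSimple := fun q ↦ (hYB q).isSimple_symm (hB q)
  have hY0 : ∀ q, 0 < (Y q).dim := fun q ↦ by rw [(hYB q).dim_eq]; exact hB0 q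
  rw [natCard_setOf_range_simple_subvariety_of_isSimple_components i hi hdesc horth hYs hY0,
    natCard_setOf_range_subvariety i hi hdesc horth hYs hY0]

end Perfect

end AbelianVariety

end Literature.AlgebraicGeometry.HodgeTheory

end
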